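import Summits.SmoothPoincare4.SmoothPoincare4.Theses.SullivanDual
import Literature.Geometry.Symplectic.TamingWitness

/-!
# Sketch — crux-ideate `stmt-SmoothPoincare4-7823` (`SullivanDual.Target`), ideator 2, round 1

First-lemma signatures of the two idea cards (they only need to ELABORATE; proofs are not
claimed here except for the pure-logic link `target_of_weakTame`).

* `CollarSupport`  — a taming witness never charges the region where `J` is standard
  (card `taubes-circle-cancellation`, shared by both cards).
* `RadiusIndependence` — below the standardness radius the witness conditions do not depend on
  the radius.
* `ClosedTamingKillsWitnesses` — if `J` (standard near `p`) is tamed by SOME smooth closed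
  2-form on `Σ ∖ p` (no condition at the end), then `J` has no taming witness at any radius below
  the standardness radius (card `crofton-pencil-laminar-charge`).
* `WeakTame` — the transferred form of the crux; `target_of_weakTame` is the logic
  `ClosedTamingKillsWitnesses → WeakTame → Target`.
-/

noncomputable section

open scoped Manifold ContDiff Topology
open Set Function Literature.Geometry.Symplectic Literature.Geometry.Kaehler

namespace Summit.SmoothPoincare4.SmoothPoincare4.Cruxes.Target.Ideas

variable {M : Type*} [TopologicalSpace M] [ChartedSpace (EuclideanSpace ℝ (Fin 4)) M] [T1Space M]

/-- `J² = -1` pointwise on `M ∖ p`. -/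
def JSq (p : M) (J : ∀ x : punctured p, TangentSpace (𝓡 4) x →L[ℝ] TangentSpace (𝓡 4) x) :
    Prop :=
  ∀ (x : punctured p) (v : TangentSpace (𝓡 4) x), J x (J x v) = -v

/-- Smoothness of the endomorphism field `J`, via `inTangentCoordinates` (verbatim the route's
clause). -/
def JSmooth [IsManifold (𝓡 4) ∞ M] (p : M)
    (J : ∀ x : punctured p, TangentSpace (𝓡 4) x →L[ℝ] TangentSpace (𝓡 4) x) : Prop :=
  ∀ x₀ : punctured p, ContMDiffAt (𝓡 4) 𝓘(ℝ, EuclideanSpace ℝ (Fin 4) →L[ℝ] EuclideanSpace ℝ (Fin 4))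
    ∞ (inTangentCoordinates (𝓡 4) (𝓡 4) (id : punctured p → punctured p) id (fun x => J x) x₀) x₀

/-- `J` is STANDARD on the punctured `ε'`-chart-ball: `⟪A (J v), b⟫ = ω₀ (A v, b)` with
`A = Dι ∘ De` (verbatim the route's `HyperbolicEnd`/`WitnessCharge` clause). -/
def JStdOn (p : M) (ε' : ℝ)
    (J : ∀ x : punctured p, TangentSpace (𝓡 4) x →L[ℝ] TangentSpace (𝓡 4) x) : Prop :=
  ∀ x : punctured p, InPuncturedChartBall p ε' x → ∀ (v : TangentSpace (𝓡 4) x)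
    (b : EuclideanSpace ℝ (Fin 4)),
    inner ℝ (fderiv ℝ inversion (extChartAt (𝓡 4) p x.1 - extChartAt (𝓡 4) p p)
      (mfderiv (𝓡 4) 𝓘(ℝ, EuclideanSpace ℝ (Fin 4)) (fun z : punctured p => extChartAt (𝓡 4) p z.1)
        x (J x v))) b =
    stdSymplecticForm (fderiv ℝ inversion (extChartAt (𝓡 4) p x.1 - extChartAt (𝓡 4) p p)
      (mfderiv (𝓡 4) 𝓘(ℝ, EuclideanSpace ℝ (Fin 4)) (fun z : punctured p => extChartAt (𝓡 4) p z.1)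
        x v)) b

/-- **Collar lemma (support form).** For `J` smooth with `J² = -1` on `Σ ∖ p`, standard on the
punctured `ε'`-ball (closed `ε'`-ball inside the chart target) and `0 < ε < ε'`: every taming
witness at radius `ε` vanishes on each smooth 2-form supported inside a SMALLER punctured ball
`B_{ε''}`, `ε'' < ε'` — i.e. witnesses live in the non-standard core. Proof idea: with
`ω̃ = d(χ λ₀)` (cut-off Liouville form of the standard end, `χ' ≥ 0`), (W3) gives `T ω̃ ≤ 0`
while `ω̃ = χ' dr ∧ λ₀ + χ ω₀` is a sum of two `J`-non-negative smooth forms (Levi form of the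
round spheres), so (W1) forces `T` to vanish on both and, by domination, on everything supported
in `{χ > 0}`; the part inside `B_ε` is `TamingWitness.eq_zero_of_vanishes_off_ball`. -/
def CollarSupport : Prop :=
  ∀ (S : Literature.Topology.FourManifolds.HomotopySphere 4) (p : S.carrier)
    (J : ∀ x : punctured p, TangentSpace (𝓡 4) x →L[ℝ] TangentSpace (𝓡 4) x) (ε ε' ε'' : ℝ),
    0 < ε → ε < ε' → 0 < ε'' → ε'' < ε' →
    Metric.closedBall (extChartAt (𝓡 4) p p) ε' ⊆ (extChartAt (𝓡 4) p).target →
    JSq p J → JSmooth p J → JStdOn p ε' J →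
    ∀ T : MForm (𝓡 4) (punctured p) ℝ 2 →ₗ[ℝ] ℝ, TamingWitness p ε J T →
      ∀ α : MForm (𝓡 4) (punctured p) ℝ 2, IsSmoothForm α →
        (∀ x : punctured p, ¬ InPuncturedChartBall p ε'' x → α x = 0) → T α = 0

/-- **Radius independence.** Under the hypotheses of `CollarSupport`, and given one smooth
closed form standard on `B_{ε'}` (the route's `ClosedModelExtension`), a taming witness at one
radius `ε₁ < ε'` is a taming witness at every other radius `ε₂ < ε'`: below the standardness
radius, (W1)–(W3) do not depend on the radius. Consequence: in `Target` the clause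
`∀ ε ≤ ε₁` may be replaced by a single radius. -/
def RadiusIndependence : Prop :=
  ∀ (S : Literature.Topology.FourManifolds.HomotopySphere 4) (p : S.carrier)
    (J : ∀ x : punctured p, TangentSpace (𝓡 4) x →L[ℝ] TangentSpace (𝓡 4) x) (ε' : ℝ),
    0 < ε' → Metric.closedBall (extChartAt (𝓡 4) p p) ε' ⊆ (extChartAt (𝓡 4) p).target →
    JSq p J → JSmooth p J → JStdOn p ε' J →
    (∃ α₀ : MForm (𝓡 4) (punctured p) ℝ 2,
      IsSmoothForm α₀ ∧ IsClosedForm α₀ ∧ IsStandardOnBall p ε' α₀) →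
    ∀ ε₁ ε₂ : ℝ, 0 < ε₁ → ε₁ < ε' → 0 < ε₂ → ε₂ < ε' →
      ∀ T : MForm (𝓡 4) (punctured p) ℝ 2 →ₗ[ℝ] ℝ,
        TamingWitness p ε₁ J T → TamingWitness p ε₂ J T

/-- **Closed taming kills witnesses (the `WeakTame` transfer).** If `J` (smooth, `J² = -1`,
standard on `B_{ε'}`) is tamed EVERYWHERE on `Σ ∖ p` by SOME smooth closed 2-form `ω` — no
standardness, no behaviour at the end prescribed — then `J` has no taming witness at any radius
`ε < ε'`. Proof idea: `H²(Σ ∖ p) = 0` makes `ω = dγ`; split `γ = φγ + (1-φ)γ` with `φ ≡ 1`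
off `B_{ε'''}`, `φ ≡ 0` on `B_ε`; (W2) kills `d(φγ)`, `CollarSupport` kills `d((1-φ)γ)`, so
`T ω = 0`, contradicting (W1). It is the current-theoretic shadow of "weak fillings of
`(S³, ξ_std)` are standard"; with `RelativeSullivanDuality` it upgrades a weakly taming closed
form to a standard-at-infinity one. -/
def ClosedTamingKillsWitnesses : Prop :=
  ∀ (S : Literature.Topology.FourManifolds.HomotopySphere 4) (p : S.carrier)
    (J : ∀ x : punctured p, TangentSpace (𝓡 4) x →L[ℝ] TangentSpace (𝓡 4) x) (ε ε' : ℝ),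
    0 < ε → ε < ε' →
    Metric.closedBall (extChartAt (𝓡 4) p p) ε' ⊆ (extChartAt (𝓡 4) p).target →
    JSq p J → JSmooth p J → JStdOn p ε' J →
    (∃ sf : MForm (𝓡 4) (punctured p) ℝ 2, IsSmoothForm sf ∧ IsClosedForm sf ∧
      ∀ (x : punctured p) (v : TangentSpace (𝓡 4) x), v ≠ 0 → 0 < sf x ![v, J x v]) →
    NoWitness p ε J

/-- **`WeakTame`** — the transferred crux: every punctured homotopy 4-sphere carries an almost
complex structure standard near the puncture which is tamed by some closed 2-form (the form is
free at the end). The two cards construct `ω` as a Crofton average over a pencil of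
pseudoholomorphic lines, resp. by cancelling the zero circles of a near-symplectic form. -/
def WeakTame : Prop :=
  ∀ (S : Literature.Topology.FourManifolds.HomotopySphere 4) (p : S.carrier),
    ∃ (J : ∀ x : punctured p, TangentSpace (𝓡 4) x →L[ℝ] TangentSpace (𝓡 4) x) (ε' : ℝ),
      0 < ε' ∧ Metric.closedBall (extChartAt (𝓡 4) p p) ε' ⊆ (extChartAt (𝓡 4) p).target ∧
      JSq p J ∧ JSmooth p J ∧ JStdOn p ε' J ∧
      ∃ sf : MForm (𝓡 4) (punctured p) ℝ 2, IsSmoothForm sf ∧ IsClosedForm sf ∧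
        ∀ (x : punctured p) (v : TangentSpace (𝓡 4) x), v ≠ 0 → 0 < sf x ![v, J x v]

/-- Pure logic: the transfer is sound — `ClosedTamingKillsWitnesses` and `WeakTame` give the
route's `Target` (take `ε₁ := ε'/2`; `NoWitness` unfolds by `Iff.rfl` to the negated
conjunction in `Target`). -/
theorem target_of_weakTame (hK : ClosedTamingKillsWitnesses) (hW : WeakTame) :
    Summit.SmoothPoincare4.SmoothPoincare4.Theses.SullivanDual.Target := by
  intro S p
  obtain ⟨J, ε', hε', hball, hJ2, hJs, hstd, sf, hωs, hωc, hωt⟩ := hW S p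
  refine ⟨J, hJ2, hJs, ε' / 2, by positivity, fun ε hε hεle T hT => ?_⟩
  have hlt : ε < ε' := lt_of_le_of_lt hεle (by linarith)
  exact hK S p J ε ε' hε hlt hball hJ2 hJs hstd ⟨sf, hωs, hωc, hωt⟩ T hT

end Summit.SmoothPoincare4.SmoothPoincare4.Cruxes.Target.Ideas
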